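import Summits.CriticalPhenomena.PercolationContinuityZ3.Theorems.PercNearOneGluingNoHeavyLowerTailCubicFourPointL1CertRows
import Summits.CriticalPhenomena.PercolationContinuityZ3.Theorems.PercNearOneGluingNoHeavyLowerTailAGPlusSwitching
import Literature.Probability.Percolation.BergKahnLogSupermodular
import HarnessLib

/-!
# `NoHeavyLowerTail` (stmt-CriticalPhenomena-4575) — four-point certificate rows from van den Berg–Kahn / van den Berg–Häggström–Kahn and `AG⁺`,
# and a generic checker for `E₃ ≥ 0` certificates that use them

Support file (prover prim-sahi-p2 gen 3; `--supports stmt-CriticalPhenomena-4575`).  No sorries, no named facts.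

prim-l12-p2's four-point kernel (`FourPointCert`, files `…CubicFourPointL1Cert{Kernel,Semantics,Patterns,Glue,Rows}`) checks identities
`lhs = Σ mult·row` over the 15 connectivity patterns of `(a,b,c,y)` with THEOREM rows Harris / Gladkov / 3PT-LB / hybrid.  This file adds the
rows needed by the certificates of prim-sahi-p2's four-point census (kit j088923 / j089865): for a label `s < 4` and label masks `A, X, B, Y`
* `bk s A X B Y`   — van den Berg–Kahn 2001 Thm 1.2: `m(Q_{A∪B}R_{X∩Y})·m(R_{X∪Y}) − m(Q_A R_X)·m(Q_B R_Y) ≥ 0` (`BergKahn.bergKahn_thm_1_2`),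
* `bhk s F G X Y`  — van den Berg–Häggström–Kahn 2006 Thm 1.1 with the increasing cluster events "`C_s` contains the label set of some member of the
  family `F`" (`BergKahn.bhk_thm_1_1`),
* `agp x z u`      — `AG⁺`: `σ·(qt − e₂(u)) − u₁u₂u₃ ≥ 0` on the three-point marginal of labels `x z u` (`AGPlusSwitching.agPlus_prodBernoulli`),
as mask polynomials (`NRow`, `nrowE`, `nrowVal`, `nrowVal_nonneg`), the certificate format "`D·E₃(T₁,T₂,T₃) − Σ λ·x_k·(new row) = Σ mult·(kernel row)`"
(`lhsE`, `checkN2`), and its soundness `sahiE3_pre_nonneg_of_checkN2`: a passing check proves `0 ≤ E₃(pre T₁, pre T₂, pre T₃)` under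
`prodBernoulli w` for every finite `V`, all weights and all labels `a b c y` (coincidences allowed).
-/

namespace Summit.CriticalPhenomena.PercolationContinuityZ3.Theorems

namespace FourPointCert

open MeasureTheory Finset Lean.Grind.CommRing Literature.Probability.Percolation Literature.Probability.LatticeModels
open Literature.Probability.Percolation.BergKahn

/-! ### Masks of cluster events of a root label -/

/-- All labels of the 4-bit mask `A` satisfy `p`. [this work] -/
def allLab (A : ℕ) (p : ℕ → Bool) : Bool := (List.range 4).all fun u => !A.testBit u || p u

/-- The mask of `Q_A ∩ R_X` for the root label `s`: `s` joined to every label of `A` and to no label of `X`. [this work] -/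
def qrMask (s A X : ℕ) : ℕ := maskOf fun π => allLab A (fun u => jn π s u) && allLab X (fun u => !jn π s u)

/-- The family event mask: `s` is joined to all labels of SOME member of `F`, and to no label of `X`. [this work] -/
def famMask (s : ℕ) (F : List ℕ) (X : ℕ) : ℕ := maskOf fun π => F.any (fun T => allLab T fun u => jn π s u) && allLab X (fun u => !jn π s u)

/-- The intersection of two family events with an avoidance. [this work] -/
def fam2Mask (s : ℕ) (F G : List ℕ) (X : ℕ) : ℕ :=
  maskOf fun π => F.any (fun T => allLab T fun u => jn π s u) && G.any (fun T => allLab T fun u => jn π s u) && allLab X (fun u => !jn π s u)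

/-- A new certificate row: `bk` (van den Berg–Kahn Thm 1.2), `bhk` (BHK Thm 1.1 with family events), `agp` (`AG⁺` of three labels). [this work] -/
inductive NRow where
  | bk (s A X B Y : ℕ)
  | bhk (s : ℕ) (F G : List ℕ) (X Y : ℕ)
  | agp (x z u : ℕ)
  deriving Repr, DecidableEq, Inhabited

/-- Validity: labels below `4`. [this work] -/
def NRow.valid : NRow → Bool
  | .bk s _ _ _ _ => decide (s < 4)
  | .bhk s _ _ _ _ => decide (s < 4)
  | .agp x z u => decide (x < 4) && decide (z < 4) && decide (u < 4)

/-- The row polynomial as an `Expr`. [this work] -/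
def nrowE : NRow → Expr
  | .bk s A X B Y => .sub (.mul (maskE (qrMask s (A ||| B) (X &&& Y))) (maskE (qrMask s 0 (X ||| Y))))
      (.mul (maskE (qrMask s A X)) (maskE (qrMask s B Y)))
  | .bhk s F G X Y => .sub (.mul (maskE (fam2Mask s F G (X &&& Y))) (maskE (qrMask s 0 (X ||| Y))))
      (.mul (maskE (famMask s F X)) (maskE (famMask s G Y)))
  | .agp x z u =>
    let c := law3 x z u false
    .sub (.mul sigmaE (.sub (.mul (maskE c.1) (maskE c.2.2.2.2)) (e2E [maskE c.2.1, maskE c.2.2.1, maskE c.2.2.2.1])))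
      (.mul (.mul (maskE c.2.1) (maskE c.2.2.1)) (maskE c.2.2.2.1))

/-- The value of a new row on a cell valuation. [this work] -/
noncomputable def nrowVal : NRow → (ℕ → ℝ) → ℝ
  | .bk s A X B Y, x => msum (qrMask s (A ||| B) (X &&& Y)) x * msum (qrMask s 0 (X ||| Y)) x - msum (qrMask s A X) x * msum (qrMask s B Y) x
  | .bhk s F G X Y, x => msum (fam2Mask s F G (X &&& Y)) x * msum (qrMask s 0 (X ||| Y)) x - msum (famMask s F X) x * msum (famMask s G Y) x
  | .agp xx z u, x =>
    let c := law3 xx z u false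
    msum full x * (msum c.1 x * msum c.2.2.2.2 x - e2val [msum c.2.1 x, msum c.2.2.1 x, msum c.2.2.2.1 x])
      - msum c.2.1 x * msum c.2.2.1 x * msum c.2.2.2.1 x

/-- `nrowE r` denotes `nrowVal r x`. [this work] -/
theorem denote_nrowE (x : ℕ → ℝ) (r : NRow) : (nrowE r).denote (ctxOf x) = nrowVal r x := by
  cases r with
  | bk s A X B Y => simp only [nrowE, nrowVal, denote_sub, denote_mul, denote_maskE]
  | bhk s F G X Y => simp only [nrowE, nrowVal, denote_sub, denote_mul, denote_maskE]
  | agp xx z u =>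
    simp only [nrowE, nrowVal, sigmaE, denote_sub, denote_mul, denote_maskE, denote_e2E, List.map_cons, List.map_nil]

/-- A new term `λ · x_k · row` (a cell index `k ≥ 15` means no cell factor: `λ · row`). [this work] -/
structure NTerm where
  /-- coefficient -/
  lam : ℕ
  /-- cell multiplier (`≥ 15`: none) -/
  cell : ℕ
  /-- the row -/
  row : NRow
  deriving Repr, Inhabited

/-- Validity of a term. [this work] -/
def NTerm.valid (t : NTerm) : Bool := t.row.valid

/-- The cell factor as an `Expr` (`1` if the index is `≥ 15`). [this work] -/
def NTerm.cellE (t : NTerm) : Expr := if t.cell < 15 then .var t.cell else .natCast 1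

/-- The value of the cell factor. [this work] -/
noncomputable def NTerm.cellVal (t : NTerm) (x : ℕ → ℝ) : ℝ := if t.cell < 15 then x t.cell else 1

/-- The term as an `Expr`. [this work] -/
def ntermE (t : NTerm) : Expr := .mul (.mul (.natCast t.lam) t.cellE) (nrowE t.row)

/-- The value of a term. [this work] -/
noncomputable def ntermVal (t : NTerm) (x : ℕ → ℝ) : ℝ := (t.lam : ℝ) * t.cellVal x * nrowVal t.row x

/-- The cell factor denotes its value. [this work] -/
theorem denote_cellE (x : ℕ → ℝ) (t : NTerm) : t.cellE.denote (ctxOf x) = t.cellVal x := by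
  unfold NTerm.cellE NTerm.cellVal
  split_ifs with h
  · exact denote_var x h
  · rw [denote_natCast, Nat.cast_one]

/-- The cell factor is nonnegative on nonnegative cells. [this work] -/
theorem cellVal_nonneg (x : ℕ → ℝ) (hx : ∀ i, 0 ≤ x i) (t : NTerm) : 0 ≤ t.cellVal x := by
  unfold NTerm.cellVal
  split_ifs
  · exact hx _
  · exact zero_le_one

/-- `ntermE t` denotes `ntermVal t x`. [this work] -/
theorem denote_ntermE (x : ℕ → ℝ) (t : NTerm) : (ntermE t).denote (ctxOf x) = ntermVal t x := by
  rw [ntermE, denote_mul, denote_mul, denote_natCast, denote_cellE, denote_nrowE, ntermVal]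

/-- The left-hand side `D·E₃(T₁,T₂,T₃) − Σ terms`. [this work] -/
def lhsE (D T₁ T₂ T₃ : ℕ) (ns : List NTerm) : Expr := .sub (.mul (.natCast D) (e3E T₁ T₂ T₃)) (sumBal 20 (ns.map ntermE))

/-- The value of the left-hand side. [this work] -/
noncomputable def lhsVal (D T₁ T₂ T₃ : ℕ) (ns : List NTerm) (x : ℕ → ℝ) : ℝ := (D : ℝ) * e3val T₁ T₂ T₃ x - (ns.map fun t => ntermVal t x).sum

/-- `lhsE` denotes `lhsVal`. [this work] -/
theorem denote_lhsE (x : ℕ → ℝ) (D T₁ T₂ T₃ : ℕ) (ns : List NTerm) :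
    (lhsE D T₁ T₂ T₃ ns).denote (ctxOf x) = lhsVal D T₁ T₂ T₃ ns x := by
  rw [lhsE, denote_sub, denote_mul, denote_natCast, denote_e3E, denote_sumBal, lhsVal, List.map_map]
  congr 2
  exact List.map_congr_left fun t _ => denote_ntermE x t

/-- **The computable identity check**: the normal forms of `D·E₃ − Σ new terms` and of `Σ mult·row` coincide. [this work] -/
def checkN2 (D T₁ T₂ T₃ : ℕ) (ns : List NTerm) (bs : List RowBlock) : Bool :=
  (lhsE D T₁ T₂ T₃ ns).toPoly == (certE bs).toPoly

/-- Soundness of `checkN2`: the identity holds in every commutative ring. [this work] -/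
theorem denote_eq_of_checkN2 {α : Type} [Lean.Grind.CommRing α] (ctx : Context α) {D T₁ T₂ T₃ : ℕ} {ns : List NTerm} {bs : List RowBlock}
    (h : checkN2 D T₁ T₂ T₃ ns bs = true) : (lhsE D T₁ T₂ T₃ ns).denote ctx = (certE bs).denote ctx :=
  Expr.eq_of_toPoly_eq ctx _ _ h

/-- A block uses no region factor. [this work] -/
def RowBlock.noReg (b : RowBlock) : Bool := b.mult.all fun t => decide (t.2.2 = 0)

/-- A multiplier term with region power `0` is nonnegative on nonnegative cells. [this work] -/
theorem multTermVal_nonneg_of_pow_zero (x : ℕ → ℝ) (t : ℕ × List ℕ × ℕ) (hx : ∀ i, 0 ≤ x i) (ht : t.2.2 = 0) : 0 ≤ multTermVal t x := by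
  unfold multTermVal
  rw [ht, pow_zero, one_mul]
  exact mul_nonneg (Nat.cast_nonneg _) (monoVal_nonneg x hx _)

/-- The kernel side is nonnegative when every block is valid and region-free. [this work] -/
theorem certVal_nonneg_noReg (x : ℕ → ℝ) (bs : List RowBlock) (hx : ∀ i, 0 ≤ x i) (hreg : ∀ b ∈ bs, b.noReg = true)
    (hrows : ∀ b ∈ bs, 0 ≤ rowVal b.row x) : 0 ≤ certVal bs x := by
  unfold certVal
  refine List.sum_nonneg ?_
  intro v hv
  obtain ⟨b, hb, rfl⟩ := List.mem_map.1 hv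
  refine List.sum_nonneg ?_
  intro u hu
  obtain ⟨t, ht, rfl⟩ := List.mem_map.1 hu
  have h0 : t.2.2 = 0 := by
    have := hreg b hb; rw [RowBlock.noReg, List.all_eq_true] at this; exact of_decide_eq_true (this t ht)
  exact mul_nonneg (multTermVal_nonneg_of_pow_zero x t hx h0) (hrows b hb)

section Semantics

variable {V : Type} [Fintype V] [DecidableEq V] (a b c y : V) (w : Sym2 V → unitInterval)

omit [Fintype V] [DecidableEq V] in
/-- `allLab A p` as a statement about the labels of `A`. [this work] -/
theorem allLab_iff (A : ℕ) (p : ℕ → Bool) : allLab A p = true ↔ ∀ u < 4, A.testBit u = true → p u = true := by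
  simp only [allLab, List.all_eq_true, List.mem_range, Bool.or_eq_true, Bool.not_eq_true']
  constructor
  · intro h u hu hA
    rcases h u hu with h | h
    · rw [hA] at h; exact absurd h (by decide)
    · exact h
  · intro h u hu
    by_cases hA : A.testBit u = true
    · exact Or.inr (h u hu hA)
    · exact Or.inl (Bool.eq_false_iff.mpr hA)

/-- The label set of a mask as a set of vertices. [this work] -/
def labS (A : ℕ) : Set V := {v | ∃ u < 4, A.testBit u = true ∧ lab a b c y u = v}

omit [Fintype V] [DecidableEq V] in
/-- Membership in `pre (qrMask s A X)`. [this work] -/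
theorem mem_pre_qrMask {s : ℕ} (hs : s < 4) (A X : ℕ) (ω : BondConfig V) :
    ω ∈ pre a b c y (qrMask s A X) ↔
      (∀ v ∈ labS a b c y A, ω ∈ openConn (lab a b c y s) v) ∧ ∀ v ∈ labS a b c y X, ω ∉ openConn (lab a b c y s) v := by
  rw [qrMask, mem_pre_maskOf, Bool.and_eq_true, allLab_iff, allLab_iff]
  constructor
  · rintro ⟨hA, hX⟩
    refine ⟨?_, ?_⟩
    · rintro v ⟨u, hu, hAu, rfl⟩; exact (jn_pat_iff a b c y ω hs hu).1 (hA u hu hAu)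
    · rintro v ⟨u, hu, hXu, rfl⟩
      have := hX u hu hXu; rw [Bool.not_eq_true'] at this
      exact (jn_pat_false_iff a b c y ω hs hu).1 this
  · rintro ⟨hA, hX⟩
    refine ⟨fun u hu hAu => (jn_pat_iff a b c y ω hs hu).2 (hA _ ⟨u, hu, hAu, rfl⟩), fun u hu hXu => ?_⟩
    rw [Bool.not_eq_true']
    exact (jn_pat_false_iff a b c y ω hs hu).2 (hX _ ⟨u, hu, hXu, rfl⟩)

omit [Fintype V] [DecidableEq V] in
/-- `pre (qrMask s A X)` is van den Berg–Kahn's `Q_A ∩ R_X` for the label sets. [this work] -/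
theorem pre_qrMask_eq {s : ℕ} (hs : s < 4) (A X : ℕ) :
    pre a b c y (qrMask s A X) =
      {ω | ∀ v ∈ labS a b c y A, ω ∈ openConn (lab a b c y s) v} ∩ {ω | ∀ v ∈ labS a b c y X, ω ∉ openConn (lab a b c y s) v} := by
  ext ω; rw [mem_pre_qrMask a b c y hs]; rfl

/-- The family predicate of a list of label masks: the cluster contains the label set of some member. [this work] -/
def famPred (F : List ℕ) (C : Set V) : Prop := ∃ T ∈ F, labS a b c y T ⊆ C

omit [Fintype V] [DecidableEq V] in
/-- `famPred` is monotone. [this work] -/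
theorem famPred_mono (F : List ℕ) : Monotone (famPred a b c y F) :=
  fun _ _ hCC' ⟨T, hT, hsub⟩ => ⟨T, hT, hsub.trans hCC'⟩

omit [Fintype V] [DecidableEq V] in
/-- The family part of the masks. [this work] -/
theorem any_allLab_iff {s : ℕ} (hs : s < 4) (F : List ℕ) (ω : BondConfig V) :
    F.any (fun T => allLab T fun u => jn (pat a b c y ω) s u) = true ↔ famPred a b c y F (openCluster ω (lab a b c y s)) := by
  rw [List.any_eq_true]
  constructor
  · rintro ⟨T, hT, hall⟩
    refine ⟨T, hT, ?_⟩
    rintro v ⟨u, hu, hTu, rfl⟩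
    exact (jn_pat_iff a b c y ω hs hu).1 ((allLab_iff _ _).1 hall u hu hTu)
  · rintro ⟨T, hT, hsub⟩
    exact ⟨T, hT, (allLab_iff _ _).2 fun u hu hTu => (jn_pat_iff a b c y ω hs hu).2 (hsub ⟨u, hu, hTu, rfl⟩)⟩

omit [Fintype V] [DecidableEq V] in
/-- `pre (famMask s F X)` is the BHK event `{C_s ∈ 𝒰_F} ∩ R_X`. [this work] -/
theorem pre_famMask_eq {s : ℕ} (hs : s < 4) (F : List ℕ) (X : ℕ) :
    pre a b c y (famMask s F X) =
      {ω | famPred a b c y F (openCluster ω (lab a b c y s))} ∩ {ω | ∀ v ∈ labS a b c y X, ω ∉ openConn (lab a b c y s) v} := by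
  ext ω
  rw [famMask, mem_pre_maskOf, Bool.and_eq_true, any_allLab_iff a b c y hs, allLab_iff]
  simp only [Set.mem_inter_iff, Set.mem_setOf_eq]
  refine and_congr_right fun _ => ⟨fun hX => ?_, fun hX u hu hXu => ?_⟩
  · rintro v ⟨u, hu, hXu, rfl⟩
    have := hX u hu hXu; rw [Bool.not_eq_true'] at this
    exact (jn_pat_false_iff a b c y ω hs hu).1 this
  · rw [Bool.not_eq_true']; exact (jn_pat_false_iff a b c y ω hs hu).2 (hX _ ⟨u, hu, hXu, rfl⟩)

omit [Fintype V] [DecidableEq V] in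
/-- `pre (fam2Mask s F G X)` is `{C_s ∈ 𝒰_F ∧ C_s ∈ 𝒰_G} ∩ R_X`. [this work] -/
theorem pre_fam2Mask_eq {s : ℕ} (hs : s < 4) (F G : List ℕ) (X : ℕ) :
    pre a b c y (fam2Mask s F G X) =
      {ω | famPred a b c y F (openCluster ω (lab a b c y s)) ∧ famPred a b c y G (openCluster ω (lab a b c y s))} ∩
        {ω | ∀ v ∈ labS a b c y X, ω ∉ openConn (lab a b c y s) v} := by
  ext ω
  rw [fam2Mask, mem_pre_maskOf, Bool.and_eq_true, Bool.and_eq_true, any_allLab_iff a b c y hs, any_allLab_iff a b c y hs, allLab_iff]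
  simp only [Set.mem_inter_iff, Set.mem_setOf_eq, and_assoc]
  refine and_congr_right fun _ => and_congr_right fun _ => ⟨fun hX => ?_, fun hX u hu hXu => ?_⟩
  · rintro v ⟨u, hu, hXu, rfl⟩
    have := hX u hu hXu; rw [Bool.not_eq_true'] at this
    exact (jn_pat_false_iff a b c y ω hs hu).1 this
  · rw [Bool.not_eq_true']; exact (jn_pat_false_iff a b c y ω hs hu).2 (hX _ ⟨u, hu, hXu, rfl⟩)

omit [Fintype V] [DecidableEq V] in
/-- Label sets of unions and intersections of masks. [this work] -/
theorem labS_or (A B : ℕ) : labS a b c y (A ||| B) = labS a b c y A ∪ labS a b c y B := by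
  ext v
  simp only [labS, Nat.testBit_or, Bool.or_eq_true, Set.mem_setOf_eq, Set.mem_union]
  constructor
  · rintro ⟨u, hu, h | h, rfl⟩
    · exact Or.inl ⟨u, hu, h, rfl⟩
    · exact Or.inr ⟨u, hu, h, rfl⟩
  · rintro (⟨u, hu, h, rfl⟩ | ⟨u, hu, h, rfl⟩)
    · exact ⟨u, hu, Or.inl h, rfl⟩
    · exact ⟨u, hu, Or.inr h, rfl⟩

omit [Fintype V] [DecidableEq V] in
/-- The label set of `X &&& Y` lies in the intersection of the label sets. [this work] -/
theorem labS_and_subset (X Y : ℕ) : labS a b c y (X &&& Y) ⊆ labS a b c y X ∩ labS a b c y Y := by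
  rintro v ⟨u, hu, h, rfl⟩
  rw [Nat.testBit_and, Bool.and_eq_true] at h
  exact ⟨⟨u, hu, h.1, rfl⟩, ⟨u, hu, h.2, rfl⟩⟩

omit [Fintype V] [DecidableEq V] in
/-- The empty label mask. [this work] -/
theorem labS_zero : labS a b c y 0 = ∅ := by
  ext v; simp [labS, Nat.zero_testBit]

/-- **`bk` rows are nonnegative** (van den Berg–Kahn 2001, Thm 1.2). [this work] -/
theorem nrowVal_bk_nonneg {s : ℕ} (hs : s < 4) (A X B Y : ℕ) : 0 ≤ nrowVal (.bk s A X B Y) (cellLaw a b c y w) := by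
  simp only [nrowVal, ← real_pre, pre_qrMask_eq a b c y hs, labS_or, labS_zero]
  have h := bergKahn_thm_1_2 w (lab a b c y s) (labS a b c y A) (labS a b c y B) (labS a b c y X) (labS a b c y Y)
  have hmono : (prodBernoulli w).real ({ω | ∀ v ∈ labS a b c y A ∪ labS a b c y B, ω ∈ openConn (lab a b c y s) v} ∩
        {ω | ∀ v ∈ labS a b c y X ∩ labS a b c y Y, ω ∉ openConn (lab a b c y s) v}) ≤
      (prodBernoulli w).real ({ω | ∀ v ∈ labS a b c y A ∪ labS a b c y B, ω ∈ openConn (lab a b c y s) v} ∩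
        {ω | ∀ v ∈ labS a b c y (X &&& Y), ω ∉ openConn (lab a b c y s) v}) :=
    measureReal_mono (Set.inter_subset_inter_right _ fun ω hω v hv => hω v (labS_and_subset a b c y X Y hv))
  have e0 : {ω : BondConfig V | ∀ v ∈ (∅ : Set V), ω ∈ openConn (lab a b c y s) v} = Set.univ := Set.eq_univ_of_forall fun _ _ h => h.elim
  rw [e0, Set.univ_inter]
  nlinarith [h, hmono, measureReal_nonneg (μ := prodBernoulli w)
    (s := {ω : BondConfig V | ∀ v ∈ labS a b c y X ∪ labS a b c y Y, ω ∉ openConn (lab a b c y s) v})]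

/-- **`bhk` rows are nonnegative** (van den Berg–Häggström–Kahn 2006, Thm 1.1). [this work] -/
theorem nrowVal_bhk_nonneg {s : ℕ} (hs : s < 4) (F G : List ℕ) (X Y : ℕ) : 0 ≤ nrowVal (.bhk s F G X Y) (cellLaw a b c y w) := by
  simp only [nrowVal, ← real_pre, pre_famMask_eq a b c y hs, pre_fam2Mask_eq a b c y hs, pre_qrMask_eq a b c y hs, labS_or, labS_zero]
  have h := bhk_thm_1_1 w (lab a b c y s) (famPred_mono a b c y F) (famPred_mono a b c y G) (labS a b c y X) (labS a b c y Y)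
  have hmono : (prodBernoulli w).real ({ω | famPred a b c y F (openCluster ω (lab a b c y s)) ∧ famPred a b c y G (openCluster ω (lab a b c y s))} ∩
        {ω | ∀ v ∈ labS a b c y X ∩ labS a b c y Y, ω ∉ openConn (lab a b c y s) v}) ≤
      (prodBernoulli w).real ({ω | famPred a b c y F (openCluster ω (lab a b c y s)) ∧ famPred a b c y G (openCluster ω (lab a b c y s))} ∩
        {ω | ∀ v ∈ labS a b c y (X &&& Y), ω ∉ openConn (lab a b c y s) v}) :=
    measureReal_mono (Set.inter_subset_inter_right _ fun ω hω v hv => hω v (labS_and_subset a b c y X Y hv))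
  have e0 : {ω : BondConfig V | ∀ v ∈ (∅ : Set V), ω ∈ openConn (lab a b c y s) v} = Set.univ := Set.eq_univ_of_forall fun _ _ h => h.elim
  rw [e0, Set.univ_inter]
  nlinarith [h, hmono, measureReal_nonneg (μ := prodBernoulli w)
    (s := {ω : BondConfig V | ∀ v ∈ labS a b c y X ∪ labS a b c y Y, ω ∉ openConn (lab a b c y s) v})]

omit [DecidableEq V] in
/-- **`agp` rows are nonnegative** (`AG⁺` on the three-point marginal of labels `x z u`). [this work] -/
theorem nrowVal_agp_nonneg {x z u : ℕ} (hx : x < 4) (hz : z < 4) (hu : u < 4) : 0 ≤ nrowVal (.agp x z u) (cellLaw a b c y w) := by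
  have h := AGPlusSwitching.agPlus_prodBernoulli w (lab a b c y x) (lab a b c y z) (lab a b c y u)
  have eT : openConn (lab a b c y x) (lab a b c y z) ∩ openConn (lab a b c y x) (lab a b c y u) =
      pre a b c y (maskOf fun π => jn π x z && jn π x u) := by
    ext ω; rw [mem_pre_maskOf, Bool.and_eq_true, jn_pat_iff a b c y ω hx hz, jn_pat_iff a b c y ω hx hu]; rfl
  have eQ : (openConn (lab a b c y x) (lab a b c y z))ᶜ ∩ (openConn (lab a b c y x) (lab a b c y u))ᶜ ∩
      (openConn (lab a b c y z) (lab a b c y u))ᶜ = pre a b c y (maskOf fun π => !jn π x z && !jn π x u && !jn π z u) := by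
    ext ω
    rw [mem_pre_maskOf, Bool.and_eq_true, Bool.and_eq_true, Bool.not_eq_true', Bool.not_eq_true', Bool.not_eq_true',
      jn_pat_false_iff a b c y ω hx hz, jn_pat_false_iff a b c y ω hx hu, jn_pat_false_iff a b c y ω hz hu]
    simp only [Set.mem_inter_iff, Set.mem_compl_iff]
  have e1 : openConn (lab a b c y x) (lab a b c y z) ∩ (openConn (lab a b c y x) (lab a b c y u))ᶜ =
      pre a b c y (maskOf fun π => jn π x z && !jn π x u) := by
    ext ω; rw [mem_pre_maskOf, Bool.and_eq_true, Bool.not_eq_true', jn_pat_iff a b c y ω hx hz, jn_pat_false_iff a b c y ω hx hu]; rfl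
  have e2 : openConn (lab a b c y x) (lab a b c y u) ∩ (openConn (lab a b c y x) (lab a b c y z))ᶜ =
      pre a b c y (maskOf fun π => jn π x u && !jn π x z) := by
    ext ω; rw [mem_pre_maskOf, Bool.and_eq_true, Bool.not_eq_true', jn_pat_iff a b c y ω hx hu, jn_pat_false_iff a b c y ω hx hz]; rfl
  have e3 : openConn (lab a b c y z) (lab a b c y u) ∩ (openConn (lab a b c y x) (lab a b c y z))ᶜ =
      pre a b c y (maskOf fun π => jn π z u && !jn π x z) := by
    ext ω; rw [mem_pre_maskOf, Bool.and_eq_true, Bool.not_eq_true', jn_pat_iff a b c y ω hz hu, jn_pat_false_iff a b c y ω hx hz]; rfl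
  rw [eT, eQ, e1, e2, e3] at h
  simp only [real_pre] at h
  simp only [nrowVal, law3, Bool.false_eq_true, ↓reduceIte, e2val, List.sum_cons, List.sum_nil, msum_full_cellLaw]
  nlinarith [h]

/-- Every valid new row is nonnegative on the cell law. [this work] -/
theorem nrowVal_nonneg (r : NRow) (hr : r.valid = true) : 0 ≤ nrowVal r (cellLaw a b c y w) := by
  cases r with
  | bk s A X B Y => exact nrowVal_bk_nonneg a b c y w (of_decide_eq_true hr) A X B Y
  | bhk s F G X Y => exact nrowVal_bhk_nonneg a b c y w (of_decide_eq_true hr) F G X Y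
  | agp x z u =>
    simp only [NRow.valid, Bool.and_eq_true, decide_eq_true_eq] at hr
    exact nrowVal_agp_nonneg a b c y w hr.1.1 hr.1.2 hr.2

omit [DecidableEq V] in
/-- `E₃` of three mask events is `e3val` of the cell law. [this work] -/
theorem sahiE3_pre_eq_e3val (T₁ T₂ T₃ : ℕ) :
    sahiE3 (prodBernoulli w) (pre a b c y T₁) (pre a b c y T₂) (pre a b c y T₃) = e3val T₁ T₂ T₃ (cellLaw a b c y w) := by
  rw [sahiE3_def]
  simp only [← pre_and, real_pre, e3val, msum_full_cellLaw]
  ring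

/-- **Soundness.**  If every new term and every kernel block is valid and region-free and `checkN2` passes, then
`0 ≤ E₃(pre T₁, pre T₂, pre T₃)` under `prodBernoulli w`, for every finite `V`, all weights and all labels. [this work] -/
theorem sahiE3_pre_nonneg_of_checkN2 {D T₁ T₂ T₃ : ℕ} {ns : List NTerm} {bs : List RowBlock} (hD : 0 < D)
    (hcheck : checkN2 D T₁ T₂ T₃ ns bs = true) (hns : ∀ t ∈ ns, t.valid = true)
    (hbs : ∀ b ∈ bs, b.row.valid = true ∧ b.wf = true ∧ b.noReg = true) :
    0 ≤ sahiE3 (prodBernoulli w) (pre a b c y T₁) (pre a b c y T₂) (pre a b c y T₃) := by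
  set x := cellLaw a b c y w with hxdef
  have hx : ∀ i, 0 ≤ x i := fun i => cellLaw_nonneg a b c y w i
  have hid := denote_eq_of_checkN2 (ctxOf x) hcheck
  rw [denote_lhsE x D T₁ T₂ T₃ ns, denote_certE x bs fun bl hbl => (hbs bl hbl).2.1] at hid
  have hcert : 0 ≤ certVal bs x := certVal_nonneg_noReg x bs hx (fun bl hbl => (hbs bl hbl).2.2)
    fun bl hbl => rowVal_nonneg_of_valid a b c y bl.row (hbs bl hbl).1 w
  have hterms : 0 ≤ (ns.map fun t => ntermVal t x).sum := by
    refine List.sum_nonneg ?_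
    intro v hv
    obtain ⟨t, ht, rfl⟩ := List.mem_map.1 hv
    exact mul_nonneg (mul_nonneg (Nat.cast_nonneg _) (cellVal_nonneg x hx t)) (nrowVal_nonneg a b c y w t.row (hns t ht))
  rw [sahiE3_pre_eq_e3val]
  have hl : lhsVal D T₁ T₂ T₃ ns x = certVal bs x := hid
  rw [lhsVal] at hl
  have hDx : 0 ≤ (D : ℝ) * e3val T₁ T₂ T₃ x := by linarith
  have hDpos : (0 : ℝ) < D := Nat.cast_pos.mpr hD
  exact (mul_nonneg_iff_of_pos_left hDpos).mp hDx

end Semantics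

end FourPointCert

end Summit.CriticalPhenomena.PercolationContinuityZ3.Theorems
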